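/-
Copyright (c) 2026 the pub-hodgecm-mathlib formalisation cell (harness21).  Prover seat hodgecm-mathlib-K2Liu-p09 (g3): Track B «K2-LIT», #184♮ = hLiu418,
payer-internal organ O5 «THE GL₁ CHARACTER ψ = λ̃⁻¹ λ̃ᶜ χ̌» of file #34 `Theorems/K2LiuDoublingZetaGL1.lean` (LEAD F0P6-plan (g10) DEAL K2/STATUS
2026-09-04T02:36:29Z; REPORT-FIRST #34 v3, K2/K2Liu-p09/g3; DEPMAP v2.5 §10 step (ψ)).
-/
import Literature.NumberTheory.Automorphic.ConjugateSelfDualLocalValues           -- ★ `μ(ϖ_{c•w}) = μ(ϖ_w)⁻¹`, `muAlg` values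
import Literature.NumberTheory.Automorphic.QuadraticIdelicNormLocalNorms           -- ★ `IsConjugateSymplectic.isConjugateSelfDual`
import Literature.NumberTheory.Automorphic.Liu2021.CheckOfChiGalConj               -- ★ `galConj_checkOfChi`, `checkOfChi_eq_one_of_smul_eq`
import Literature.NumberTheory.Automorphic.Liu2021.CheckOfChiConjugateOrthogonal    -- ★ `toHeckeCharacter_inv`
import Literature.NumberTheory.Automorphic.Liu2021.Def411WeilCarriersChiUnitary    -- ★ `norm_chi_apply_eq_one_cm`
import Literature.NumberTheory.Automorphic.Liu2021.LemD1SplitPlaceHeckeEigenvaluesJunction  -- ★ `complexConj_mul_complexConj'`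
import Literature.NumberTheory.Automorphic.IdeleClassCharacterConjugate            -- ★ `toHeckeCharacter_galConj`
import Literature.NumberTheory.Automorphic.NormGroupClosedProofs                   -- ★ `smul_posRealIdele`
import Literature.NumberTheory.Automorphic.AdicCompletionDegreeOnePlaceEquiv       -- ★ `absNorm_eq_absNorm_under_of_smul_ne`
import Literature.NumberTheory.Automorphic.UnitaryGroupSplitPlace                  -- ★ `PlacesOver.eq_or_eq_galInv`
import HarnessLib

/-!
# Crux `HLiu418`, Track B road `K2_Liu`, file #34 — organ O5 «THE GL₁ CHARACTER `ψ = λ̃⁻¹ λ̃ᶜ χ̌` OF s23 AND ★ #30s's HYPOTHESIS (H) AT A SPLIT PLACE»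

Cell `hodgecm-mathlib`, crux item hLiu418 = `stmt-HodgeConjecture-24832`, route of record `HCCMUnconditional`; squad K2 ∕ K2Liu, prover K2Liu-p09 (g3).
THEOREMS ONLY (no `def`, no instance, no notation, no named-fact hypothesis, no `sorry`, default heartbeats); lane
`--supports stmt-HodgeConjecture-24832 --as helper` (count-neutral).

s23's witness `ψ` (the character with `∏_{v∉S} c_v(s) = ζ^S_L(s+½)·L^S(s+½, ψ)·B^S(s)`, ★ #30s) is, in ★ carriers,
`Ψ := (μ^{alg})⁻¹ · ((μ^{alg})ᶜ · χ̌)`, `μ^{alg} = muAlg L lam` (★ `IdeleClassGroup.muAlg`), `(·)ᶜ = HeckeCharacter.galConj c`, `χ̌ = checkOfChi _ χ`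
— the two summands of ★ #30a's `T_{w,1}`-eigenvalue are `μ₁ = μ^{alg}`, `μ₂ = (μ^{alg})ᶜ χ̌`, and `Ψ = μ₁⁻¹ μ₂ = λ̃⁻¹ λ̃ᶜ χ̌` (U1′'s `ν`).  This file:
* §1 `Ψ = λ̃⁻¹ λ̃ᶜ χ̌` (the `‖·‖^{−1/2}` twists cancel, ★ `galConj_normSqrtCharacter`); `Ψ` is UNITARY; `Ψ(z(t)) = 1` on the positive real idèles
  (`c` fixes `z(t)` ★ `smul_posRealIdele`, `χ̌(z(t)) = 1` ★ `checkOfChi_eq_one_of_smul_eq`) — NO weight hypothesis is needed;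
  `Ψ` is unramified wherever `λ̃` is unramified at `w` and `c • w` and `χ̌` at `w`; and `Ψᶜ = Ψ⁻¹` (★ `galConj_checkOfChi`), whence
  `Ψ(ϖ_{c•w}) = Ψ(ϖ_w)⁻¹` off the ramification.
* §2 `splitPlace_H` — **★ #30s's hypothesis (H) at a split good place from ★ #28s's cleared identity**: with `a₁ = μ₁(ϖ_w) + μ₂(ϖ_w)`,
  `a₂ = μ₁(ϖ_w) μ₂(ϖ_w) ∕ N(w)` (★ O2/O3a's eigenvalues), `χ_D = toHeckeCharacter L lam⁻¹`:
  `Den₁ = (1 − q^{−(s+½)})(1 − Ψ(ϖ_w) q^{−(s+½)})`, `Den₂ = a₂ · (1 − q^{−(s+½)})(1 − Ψ(ϖ_{c•w}) q^{−(s+½)})` (★ `valueAtUniformizer_muAlg`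
  `μ^{alg}(ϖ_w) = λ̃(ϖ_w)√q`, ★ `valueAtUniformizer_toHeckeCharacter_complexConj_smul` `λ̃(ϖ_{c•w}) = λ̃(ϖ_w)⁻¹`, §1), so `c·Den₁·Den₂ = a₂·Num` gives
  `c · ∏_{w'∣v}(1 − q_{w'}^{−(s+½)})(1 − Ψ(ϖ_{w'})q_{w'}^{−(s+½)}) = (1 − θ q_v^{−(2s+2)})(1 − θ q_v^{−(2s+1)})` with `θ = χ_D(ϖ_w)χ_D(ϖ_{w̄})`
  (the fibre `{w' ∣ v} = {w, c⁻¹ w}` ★ `PlacesOver.eq_or_eq_galInv`, `q_w = q_{w̄} = q_v` ★ `absNorm_eq_absNorm_under_of_smul_ne`).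

HONEST LABEL: HC_CM is proved only modulo the printed citations (2 remaining named inputs: hLiu418 = stmt-HodgeConjecture-24832,
h413 = stmt-HodgeConjecture-24833) until rung 0 closes; this file is bookkeeping toward socket s23 and closes no item.
References: [Liu2021] Def. 4.1, §4.1 (l. 1922), App. D proof of Lem. D.1 (p. 126); [Li1992] §3 Thm. 3.1; [Liu2011] §2C (2-4) p. 863.
-/

set_option autoImplicit false
set_option linter.dupNamespace false

noncomputable section

open NumberField IsDedekindDomain
open scoped NNReal
open Literature.NumberTheory.Automorphic Literature.NumberTheory.Automorphic.IdeleClassGroup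
open Literature.NumberTheory.Automorphic.Liu2021 Literature.NumberTheory.Automorphic.Liu2021.Def411WeilCarriers
open Literature.NumberTheory.Automorphic.Liu2021.CheckOfChi
open Literature.NumberTheory.GaloisRepresentations

namespace Summit.HodgeConjecture.HodgeConjecture.Cruxes.HLiu418.K2LiuDoublingZetaGL1Character

variable (L : Type) [Field L] [NumberField L] [IsCMField L]
  (lam : IdeleClassGroup L →ₜ* Circle) (χ : Chi (↥(maximalRealSubfield L)) L (IsCMField.complexConj L))

/-! ## §1 `Ψ = λ̃⁻¹ λ̃ᶜ χ̌`: unitarity, the positive real idèles, ramification, `Ψᶜ = Ψ⁻¹` -/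

/-- **`(μ^{alg})⁻¹ (μ^{alg})ᶜ χ̌ = λ̃⁻¹ λ̃ᶜ χ̌`**: the twists `‖·‖^{−1/2}` cancel (`μ^{alg} = λ̃ · (‖·‖^{1/2})⁻¹`, `(‖·‖^{1/2})ᶜ = ‖·‖^{1/2}`).
[cite: Liu2021, §4.1 (l. 1922)] -/
theorem character_eq :
    (muAlg L lam)⁻¹ * (HeckeCharacter.galConj (IsCMField.complexConj L) (muAlg L lam) *
        HeckeCharacter.checkOfChi (complexConj_mul_complexConj' L) χ) =
      (toHeckeCharacter L lam)⁻¹ * (HeckeCharacter.galConj (IsCMField.complexConj L) (toHeckeCharacter L lam) *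
        HeckeCharacter.checkOfChi (complexConj_mul_complexConj' L) χ) := by
  rw [muAlg, HeckeCharacter.galConj_mul, HeckeCharacter.galConj_inv, galConj_normSqrtCharacter, mul_inv, inv_inv]
  -- commutative group algebra: `λ̃⁻¹ N (λ̃ᶜ N⁻¹ χ̌) = λ̃⁻¹ λ̃ᶜ χ̌`
  set A := toHeckeCharacter L lam
  set N := normSqrtCharacter L
  set B := HeckeCharacter.galConj (IsCMField.complexConj L) (toHeckeCharacter L lam)
  set C := HeckeCharacter.checkOfChi (complexConj_mul_complexConj' L) χ
  calc A⁻¹ * N * (B * N⁻¹ * C) = A⁻¹ * (B * C) * (N * N⁻¹) := by simp only [mul_comm, mul_left_comm, mul_assoc]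
    _ = A⁻¹ * (B * C) := by rw [mul_inv_cancel, mul_one]

omit [IsCMField L] in
/-- the conjugate `λ̃ᶜ` of a unitary character is unitary (same values). [cite: Liu2021, Def. 4.1] -/
theorem isUnitary_galConj {η : HeckeCharacter L} (hη : η.IsUnitary) (σ : L ≃ₐ[↥(maximalRealSubfield L)] L) :
    (HeckeCharacter.galConj σ η).IsUnitary := fun x => by
  rw [HeckeCharacter.galConj_apply]
  exact hη _

/-- `χ̌` is unitary (`χ` is: ★ `norm_chi_apply_eq_one_cm`). [cite: Liu2021, Def. 4.11 (l. 2090); App. D §D.1 (l. 5224)] -/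
theorem isUnitary_checkOfChi : (HeckeCharacter.checkOfChi (complexConj_mul_complexConj' L) χ).IsUnitary := fun x => by
  rw [checkOfChi_apply]
  exact norm_chi_apply_eq_one_cm L χ _

/-- **`Ψ` IS UNITARY.** [cite: Liu2021, Def. 4.1, §4.1 (l. 1922)] -/
theorem isUnitary_character :
    ((muAlg L lam)⁻¹ * (HeckeCharacter.galConj (IsCMField.complexConj L) (muAlg L lam) *
        HeckeCharacter.checkOfChi (complexConj_mul_complexConj' L) χ)).IsUnitary := by
  rw [character_eq]
  exact (isUnitary_toHeckeCharacter L lam).inv.mul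
    ((isUnitary_galConj L (isUnitary_toHeckeCharacter L lam) _).mul (isUnitary_checkOfChi L χ))

/-- **`Ψ(z(t)) = 1` on the positive real idèles** (`c • z(t) = z(t)`, so `λ̃⁻¹(z)λ̃(c • z) = 1` and `χ̌(z) = 1`); no weight hypothesis.
[cite: Liu2021, Def. 4.1; App. D §D.1 (l. 5224)] -/
theorem character_posRealIdele (t : ℝ≥0ˣ) :
    ((muAlg L lam)⁻¹ * (HeckeCharacter.galConj (IsCMField.complexConj L) (muAlg L lam) *
        HeckeCharacter.checkOfChi (complexConj_mul_complexConj' L) χ)) (posRealIdele L t) = 1 := by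
  rw [character_eq, HeckeCharacter.mul_apply, HeckeCharacter.mul_apply, HeckeCharacter.inv_apply, HeckeCharacter.galConj_apply,
    smul_posRealIdele,
    checkOfChi_eq_one_of_smul_eq (complexConj_mul_complexConj' L) χ
      (smul_posRealIdele (↥(maximalRealSubfield L)) L (IsCMField.complexConj L) t),
    mul_one, inv_mul_cancel]

/-- **`Ψ` is unramified at `w`** as soon as `λ̃` is unramified at `w` and at `c • w` and `χ̌` at `w`. [cite: Liu2021, §4.1 (l. 1922)] -/
theorem isUnramifiedAt_character (w : HeightOneSpectrum (𝓞 L)) (h1 : (toHeckeCharacter L lam).IsUnramifiedAt w)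
    (h2 : (toHeckeCharacter L lam).IsUnramifiedAt (IsCMField.complexConj L • w))
    (h3 : (HeckeCharacter.checkOfChi (complexConj_mul_complexConj' L) χ).IsUnramifiedAt w) :
    ((muAlg L lam)⁻¹ * (HeckeCharacter.galConj (IsCMField.complexConj L) (muAlg L lam) *
        HeckeCharacter.checkOfChi (complexConj_mul_complexConj' L) χ)).IsUnramifiedAt w := by
  rw [character_eq]
  exact h1.inv'.mul' (((HeckeCharacter.isUnramifiedAt_galConj_iff _ _ w).2 h2).mul' h3)

/-- **`Ψᶜ = Ψ⁻¹`** (`c² = 1`, `χ̌ᶜ = χ̌⁻¹` ★ `galConj_checkOfChi`). [cite: Liu2021, Def. 4.1; Lemma D.1 (4) (l. 5235)] -/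
theorem galConj_character :
    HeckeCharacter.galConj (IsCMField.complexConj L)
        ((muAlg L lam)⁻¹ * (HeckeCharacter.galConj (IsCMField.complexConj L) (muAlg L lam) *
          HeckeCharacter.checkOfChi (complexConj_mul_complexConj' L) χ)) =
      ((muAlg L lam)⁻¹ * (HeckeCharacter.galConj (IsCMField.complexConj L) (muAlg L lam) *
          HeckeCharacter.checkOfChi (complexConj_mul_complexConj' L) χ))⁻¹ := by
  rw [HeckeCharacter.galConj_mul, HeckeCharacter.galConj_mul, HeckeCharacter.galConj_inv, HeckeCharacter.galConj_galConj,
    complexConj_mul_complexConj' L, galConj_checkOfChi]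
  have h1 : HeckeCharacter.galConj (1 : L ≃ₐ[↥(maximalRealSubfield L)] L) (muAlg L lam) = muAlg L lam := by
    ext x
    rw [HeckeCharacter.galConj_apply, one_smul]
  rw [h1, mul_inv, mul_inv, inv_inv]
  exact mul_left_comm _ _ _

/-- **`Ψ(ϖ_{c•w}) = Ψ(ϖ_w)⁻¹`** when `Ψ` is unramified at `c • w` (transport of uniformisers + `Ψᶜ = Ψ⁻¹`). [cite: Liu2021, Def. 4.1] -/
theorem valueAtUniformizer_character_smul (w : HeightOneSpectrum (𝓞 L))
    (h : ((muAlg L lam)⁻¹ * (HeckeCharacter.galConj (IsCMField.complexConj L) (muAlg L lam) *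
        HeckeCharacter.checkOfChi (complexConj_mul_complexConj' L) χ)).IsUnramifiedAt (IsCMField.complexConj L • w)) :
    ((muAlg L lam)⁻¹ * (HeckeCharacter.galConj (IsCMField.complexConj L) (muAlg L lam) *
        HeckeCharacter.checkOfChi (complexConj_mul_complexConj' L) χ)).valueAtUniformizer (IsCMField.complexConj L • w) =
      (((muAlg L lam)⁻¹ * (HeckeCharacter.galConj (IsCMField.complexConj L) (muAlg L lam) *
        HeckeCharacter.checkOfChi (complexConj_mul_complexConj' L) χ)).valueAtUniformizer w)⁻¹ := by
  rw [← HeckeCharacter.valueAtUniformizer_galConj_of_isUnramifiedAt (IsCMField.complexConj L) _ w h, galConj_character,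
    HeckeCharacter.valueAtUniformizer_inv']

/-! ## §2 ★ #30s's hypothesis (H) at a split good place, from ★ #28s's cleared identity -/

/-- square roots of residue cardinalities as complex powers: `√q · q^{−(s+1)} = q^{−(s+½)}`, `√q · √q = q` and
`q^{−(s+½)} · q^{−(s+½)} = q^{−(2s+1)}`. [folklore] -/
theorem sqrt_mul_cpow {q : ℕ} (hq : 0 < q) (s : ℂ) :
    ((Real.sqrt (q : ℝ) : ℝ) : ℂ) * (q : ℂ) ^ (-(s + 1)) = (q : ℂ) ^ (-(s + 1 / 2)) ∧
    ((Real.sqrt (q : ℝ) : ℝ) : ℂ) * ((Real.sqrt (q : ℝ) : ℝ) : ℂ) = (q : ℂ) ∧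
    (q : ℂ) ^ (-(s + 1 / 2)) * (q : ℂ) ^ (-(s + 1 / 2)) = (q : ℂ) ^ (-(2 * s + 1)) := by
  have hq0 : (q : ℂ) ≠ 0 := Nat.cast_ne_zero.2 hq.ne'
  have hsq : ((Real.sqrt (q : ℝ) : ℝ) : ℂ) = (q : ℂ) ^ ((1 / 2 : ℂ)) := by
    rw [Real.sqrt_eq_rpow, Complex.ofReal_cpow (Nat.cast_nonneg q)]
    push_cast
    rfl
  refine ⟨?_, ?_, ?_⟩
  · rw [hsq, ← Complex.cpow_add _ _ hq0]; congr 1; ring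
  · rw [← Complex.ofReal_mul, Real.mul_self_sqrt (Nat.cast_nonneg q), Complex.ofReal_natCast]
  · rw [← Complex.cpow_add _ _ hq0]; congr 1; ring

/-- **ORGAN O5 OF #34 — ★ #30s's (H) AT A SPLIT GOOD PLACE.**  `w ∣ v` split (`c • w ≠ w`), `λ̃ = toHeckeCharacter L lam` conjugate symplectic and unramified at
`c • w`, `Ψ` unramified at `c • w`; `μ₁ := μ^{alg}`, `μ₂ := (μ^{alg})ᶜ χ̌`, `a₁ := μ₁(ϖ_w) + μ₂(ϖ_w)`, `a₂ := μ₁(ϖ_w) μ₂(ϖ_w) ∕ N(w)`, `χ_D := toHeckeCharacter L lam⁻¹`.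
If `c₀` satisfies ★ #28s's cleared identity `c₀ · Den₁ · Den₂ = a₂ · Num` at `(a₁, a₂, χ_D, w, s)`, then `c₀` satisfies ★ #30s's (H) at `v` with `ψ := Ψ` and
`θ₁ v = θ₂ v = θ := χ_D(ϖ_w) χ_D(ϖ_{c⁻¹ w})` (`= λ̃(ϖ_w)⁻¹ λ̃(ϖ_w) = 1`):
`c₀ · ∏ᶠ_{w' ∣ v} (1 − q_{w'}^{−(s+½)})(1 − Ψ(ϖ_{w'}) q_{w'}^{−(s+½)}) = (1 − θ q_v^{−(2s+2)})(1 − θ q_v^{−(2s+1)})`.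
Proof: `Den₁ = (1 − q^{−(s+½)})(1 − Ψ(ϖ_w) q^{−(s+½)})`, `Den₂ = a₂ (1 − q^{−(s+½)})(1 − Ψ(ϖ_w)⁻¹ q^{−(s+½)})`, `a₂ = λ̃(ϖ_w)² Ψ(ϖ_w) ≠ 0`.
[cite: Liu2021, App. D proof of Lem. D.1 (p. 126)] [cite: Li1992, §3 Thm. 3.1] [cite: Liu2011, §2C (2-4) p. 863] -/
theorem splitPlace_H (hlam : IsConjugateSymplectic L lam)
    {v : HeightOneSpectrum (𝓞 (↥(maximalRealSubfield L)))} (w : UnitaryGroup.PlacesOver L v)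
    (hw : IsCMField.complexConj L • w.1 ≠ w.1)
    (hunr : (toHeckeCharacter L lam).IsUnramifiedAt (IsCMField.complexConj L • w.1))
    (hΨ : ((muAlg L lam)⁻¹ * (HeckeCharacter.galConj (IsCMField.complexConj L) (muAlg L lam) *
        HeckeCharacter.checkOfChi (complexConj_mul_complexConj' L) χ)).IsUnramifiedAt (IsCMField.complexConj L • w.1))
    (s c₀ : ℂ)
    (hId : c₀ *
        ((1 - (toHeckeCharacter L lam⁻¹).valueAtUniformizer w.1 *
              ((muAlg L lam).valueAtUniformizer w.1 +
                (HeckeCharacter.galConj (IsCMField.complexConj L) (muAlg L lam) *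
                  HeckeCharacter.checkOfChi (complexConj_mul_complexConj' L) χ).valueAtUniformizer w.1) *
              (w.1.residueCard : ℂ) ^ (-(s + 1)) +
            (toHeckeCharacter L lam⁻¹).valueAtUniformizer w.1 ^ 2 *
              ((muAlg L lam).valueAtUniformizer w.1 *
                (HeckeCharacter.galConj (IsCMField.complexConj L) (muAlg L lam) *
                  HeckeCharacter.checkOfChi (complexConj_mul_complexConj' L) χ).valueAtUniformizer w.1 /
                (Ideal.absNorm w.1.asIdeal : ℂ)) *
              (w.1.residueCard : ℂ) ^ (-(2 * s + 1))) *
          ((muAlg L lam).valueAtUniformizer w.1 *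
                (HeckeCharacter.galConj (IsCMField.complexConj L) (muAlg L lam) *
                  HeckeCharacter.checkOfChi (complexConj_mul_complexConj' L) χ).valueAtUniformizer w.1 /
                (Ideal.absNorm w.1.asIdeal : ℂ) -
            (toHeckeCharacter L lam⁻¹).valueAtUniformizer (UnitaryGroup.PlacesOver.galInv (IsCMField.complexConj L) w).1 *
              ((muAlg L lam).valueAtUniformizer w.1 +
                (HeckeCharacter.galConj (IsCMField.complexConj L) (muAlg L lam) *
                  HeckeCharacter.checkOfChi (complexConj_mul_complexConj' L) χ).valueAtUniformizer w.1) *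
              (w.1.residueCard : ℂ) ^ (-(s + 1)) +
            (toHeckeCharacter L lam⁻¹).valueAtUniformizer (UnitaryGroup.PlacesOver.galInv (IsCMField.complexConj L) w).1 ^ 2 *
              (w.1.residueCard : ℂ) ^ (-(2 * s + 1)))) =
        (muAlg L lam).valueAtUniformizer w.1 *
              (HeckeCharacter.galConj (IsCMField.complexConj L) (muAlg L lam) *
                HeckeCharacter.checkOfChi (complexConj_mul_complexConj' L) χ).valueAtUniformizer w.1 /
              (Ideal.absNorm w.1.asIdeal : ℂ) *
          (1 - (toHeckeCharacter L lam⁻¹).valueAtUniformizer w.1 *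
              (toHeckeCharacter L lam⁻¹).valueAtUniformizer (UnitaryGroup.PlacesOver.galInv (IsCMField.complexConj L) w).1 *
                  (w.1.residueCard : ℂ) ^ (-(2 * s + 2))) *
            (1 - (toHeckeCharacter L lam⁻¹).valueAtUniformizer w.1 *
              (toHeckeCharacter L lam⁻¹).valueAtUniformizer (UnitaryGroup.PlacesOver.galInv (IsCMField.complexConj L) w).1 *
                  (w.1.residueCard : ℂ) ^ (-(2 * s + 1)))) :
    c₀ * ∏ᶠ w' : UnitaryGroup.PlacesOver L v,
        ((1 - (w'.1.residueCard : ℂ) ^ (-(s + 1 / 2))) *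
          (1 - ((muAlg L lam)⁻¹ * (HeckeCharacter.galConj (IsCMField.complexConj L) (muAlg L lam) *
              HeckeCharacter.checkOfChi (complexConj_mul_complexConj' L) χ)).valueAtUniformizer w'.1 * (w'.1.residueCard : ℂ) ^ (-(s + 1 / 2)))) =
      (1 - (toHeckeCharacter L lam⁻¹).valueAtUniformizer w.1 *
              (toHeckeCharacter L lam⁻¹).valueAtUniformizer (UnitaryGroup.PlacesOver.galInv (IsCMField.complexConj L) w).1 *
            (v.residueCard : ℂ) ^ (-(2 * s + 2))) *
        (1 - (toHeckeCharacter L lam⁻¹).valueAtUniformizer w.1 *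
              (toHeckeCharacter L lam⁻¹).valueAtUniformizer (UnitaryGroup.PlacesOver.galInv (IsCMField.complexConj L) w).1 *
            (v.residueCard : ℂ) ^ (-(2 * s + 1))) := by
  classical
  -- ### names for the local values
  set Ψ := (muAlg L lam)⁻¹ * (HeckeCharacter.galConj (IsCMField.complexConj L) (muAlg L lam) *
        HeckeCharacter.checkOfChi (complexConj_mul_complexConj' L) χ) with hΨdef
  set μ₁ : ℂ := (muAlg L lam).valueAtUniformizer w.1 with hμ₁
  set μ₂ : ℂ := (HeckeCharacter.galConj (IsCMField.complexConj L) (muAlg L lam) *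
        HeckeCharacter.checkOfChi (complexConj_mul_complexConj' L) χ).valueAtUniformizer w.1 with hμ₂
  set l : ℂ := (toHeckeCharacter L lam).valueAtUniformizer w.1 with hl
  set q : ℕ := w.1.residueCard with hqdef
  set r : ℂ := ((Real.sqrt (q : ℝ) : ℝ) : ℂ) with hr
  set P : ℂ := Ψ.valueAtUniformizer w.1 with hP
  -- ### `c⁻¹ = c`, the conjugate place `w̄ = c • w`, residue cardinalities `q_w = q_{w̄} = q_v`
  have hcinv : (IsCMField.complexConj L)⁻¹ = IsCMField.complexConj L := inv_eq_of_mul_eq_one_right (complexConj_mul_complexConj' L)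
  have hwbar : (UnitaryGroup.PlacesOver.galInv (IsCMField.complexConj L) w).1 = IsCMField.complexConj L • w.1 := by
    show (IsCMField.complexConj L)⁻¹ • w.1 = _
    rw [hcinv]
  have hqw : (Ideal.absNorm w.1.asIdeal : ℂ) = (q : ℂ) := by
    rw [hqdef, HeightOneSpectrum.residueCard]
  have hqv : (v.residueCard : ℂ) = (q : ℂ) := by
    rw [hqdef, HeightOneSpectrum.residueCard, HeightOneSpectrum.residueCard,
      absNorm_eq_absNorm_under_of_smul_ne (↥(maximalRealSubfield L)) (IsCMField.complexConj L) hw, w.2]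
  have hqbar : ((IsCMField.complexConj L • w.1).residueCard : ℂ) = (q : ℂ) := by
    rw [hqdef, HeightOneSpectrum.residueCard, HeightOneSpectrum.residueCard, HeightOneSpectrum.absNorm_algEquiv_smul]
  have hqpos : 0 < q := lt_trans Nat.zero_lt_one (HeightOneSpectrum.one_lt_residueCard w.1)
  have hq0 : (q : ℂ) ≠ 0 := Nat.cast_ne_zero.2 hqpos.ne'
  obtain ⟨hX, hrr, hXX⟩ := sqrt_mul_cpow hqpos s
  -- ### the local values: `χ_D(ϖ_w) = λ̃(ϖ_w)⁻¹`, `χ_D(ϖ_{w̄}) = λ̃(ϖ_w)`, `μ₁ = λ̃(ϖ_w) √q`, `μ₂ = μ₁ Ψ(ϖ_w)`, `Ψ(ϖ_{w̄}) = Ψ(ϖ_w)⁻¹`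
  have hl0 : l ≠ 0 := valueAtUniformizer_toHeckeCharacter_ne_zero lam w.1
  have hχw : (toHeckeCharacter L lam⁻¹).valueAtUniformizer w.1 = l⁻¹ := by
    rw [toHeckeCharacter_inv, HeckeCharacter.valueAtUniformizer_inv']
  have hχbar : (toHeckeCharacter L lam⁻¹).valueAtUniformizer (UnitaryGroup.PlacesOver.galInv (IsCMField.complexConj L) w).1 = l := by
    rw [hwbar, toHeckeCharacter_inv, HeckeCharacter.valueAtUniformizer_inv',
      valueAtUniformizer_toHeckeCharacter_complexConj_smul hlam.isConjugateSelfDual w.1 hunr, inv_inv]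
  have hμ₁v : μ₁ = l * r := valueAtUniformizer_muAlg L lam w.1
  have hμ₁0 : μ₁ ≠ 0 := Units.ne_zero _
  have hμ₂v : μ₂ = μ₁ * P := by
    rw [hP, hΨdef, HeckeCharacter.valueAtUniformizer_mul', HeckeCharacter.valueAtUniformizer_inv', ← hμ₁, ← hμ₂,
      mul_inv_cancel_left₀ hμ₁0]
  have hP0 : P ≠ 0 := Units.ne_zero _
  have hΨbar : Ψ.valueAtUniformizer (IsCMField.complexConj L • w.1) = P⁻¹ :=
    valueAtUniformizer_character_smul L lam χ w.1 hΨ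
  have ha₂ : μ₁ * μ₂ / (q : ℂ) = l ^ 2 * P := by
    rw [div_eq_iff hq0, hμ₂v, hμ₁v, ← hrr]
    ring
  -- ### the fibre `{w' ∣ v} = {w, w̄}`, `w̄ ≠ w`
  have hne : UnitaryGroup.PlacesOver.galInv (IsCMField.complexConj L) w ≠ w := fun h => by
    have h' : (UnitaryGroup.PlacesOver.galInv (IsCMField.complexConj L) w).1 = w.1 := congrArg Subtype.val h
    rw [hwbar] at h'
    exact hw h'
  have hfib : ∏ᶠ w' : UnitaryGroup.PlacesOver L v,
        ((1 - (w'.1.residueCard : ℂ) ^ (-(s + 1 / 2))) * (1 - Ψ.valueAtUniformizer w'.1 * (w'.1.residueCard : ℂ) ^ (-(s + 1 / 2)))) =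
      (1 - (q : ℂ) ^ (-(s + 1 / 2))) * (1 - P * (q : ℂ) ^ (-(s + 1 / 2))) *
        ((1 - (q : ℂ) ^ (-(s + 1 / 2))) * (1 - P⁻¹ * (q : ℂ) ^ (-(s + 1 / 2)))) := by
    rw [finprod_eq_prod_of_mulSupport_subset _
        (s := ({w, UnitaryGroup.PlacesOver.galInv (IsCMField.complexConj L) w} : Finset (UnitaryGroup.PlacesOver L v)))
        (fun w' _ => by
          rcases UnitaryGroup.PlacesOver.eq_or_eq_galInv (IsCMField.complexConj L) (IsCMField.complexConj_ne_one L) w w' with h | h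
          · simp [h]
          · simp [h]),
      Finset.prod_pair hne.symm, hwbar, hqbar, hΨbar]
  -- ### the algebra: `Den₁ = F(w)`, `Den₂ = a₂ · F(w̄)`; cancel `a₂ = λ̃(ϖ_w)² Ψ(ϖ_w) ≠ 0`
  rw [hfib, hqv, hχw, hχbar]
  rw [hχw, hχbar, hqw, ha₂] at hId
  have hDen₁ : 1 - l⁻¹ * (μ₁ + μ₂) * (q : ℂ) ^ (-(s + 1)) + l⁻¹ ^ 2 * (l ^ 2 * P) * (q : ℂ) ^ (-(2 * s + 1)) =
      (1 - (q : ℂ) ^ (-(s + 1 / 2))) * (1 - P * (q : ℂ) ^ (-(s + 1 / 2))) := by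
    rw [hμ₂v, hμ₁v, ← hXX, ← hX]
    field_simp
    ring
  have hDen₂ : l ^ 2 * P - l * (μ₁ + μ₂) * (q : ℂ) ^ (-(s + 1)) + l ^ 2 * (q : ℂ) ^ (-(2 * s + 1)) =
      l ^ 2 * P * ((1 - (q : ℂ) ^ (-(s + 1 / 2))) * (1 - P⁻¹ * (q : ℂ) ^ (-(s + 1 / 2)))) := by
    rw [hμ₂v, hμ₁v, ← hXX, ← hX]
    field_simp
    ring
  rw [hDen₁, hDen₂] at hId
  have key : l ^ 2 * P * (c₀ * ((1 - (q : ℂ) ^ (-(s + 1 / 2))) * (1 - P * (q : ℂ) ^ (-(s + 1 / 2))) *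
      ((1 - (q : ℂ) ^ (-(s + 1 / 2))) * (1 - P⁻¹ * (q : ℂ) ^ (-(s + 1 / 2)))))) =
      l ^ 2 * P * ((1 - l⁻¹ * l * (q : ℂ) ^ (-(2 * s + 2))) * (1 - l⁻¹ * l * (q : ℂ) ^ (-(2 * s + 1)))) := by
    linear_combination hId
  exact mul_left_cancel₀ (mul_ne_zero (pow_ne_zero 2 hl0) hP0) key

end Summit.HodgeConjecture.HodgeConjecture.Cruxes.HLiu418.K2LiuDoublingZetaGL1Character

end
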